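import Literature.AlgebraicGeometry.AbelianSchemes.AbelianSchemeKOfLLocal
import Literature.AlgebraicGeometry.Motives.SeesawRelativeChartCover
import HarnessLib

/-!
# `K(L)` is a seesaw subscheme: the closed subscheme `K(L) ⊆ A` from the relative seesaw theorem

Layer `Literature/AlgebraicGeometry/AbelianSchemes`, namespace `Literature.AlgebraicGeometry.AbelianSchemes.AbelianSchemeOver`.
Cell `hodgecm-mathlib` (D-0151), F-DAG price sheet §5 (h5-C) road (C1) «`K(L) ↪ A` is a closed subscheme» = the thin
ADAPTER between the ★ functor-of-points layer of `K(L)` (★ `AbelianSchemeKOfL` / `AbelianSchemeKOfLLocal`: `MemKOfL`,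
`kOfL`, Mumford's bundle `Λ(L)`, `(1, u)^*[Λ] = 1`) and the ★ relative seesaw head (★ `SeesawRelativeChartCover.exists_seesawSubscheme_of_repr'`); count-neutral
capital (author B-p05 (g16)).  HC_CM is proved only modulo the 7 printed citations until rung 0 closes; this file
asserts nothing about HC.

## Mathematics

[MumfordAV1970] §13 defines `K(L) ⊆ X` as «the maximal subscheme over which `m^*L ⊗ p₁^*L⁻¹` comes from the base», i.e.
through the seesaw theorem ([MumfordAV1970] §10 Seesaw, relative form [GortzWedhorn2023] Thm. 24.66) applied to the family
`p₂ : X × X → X` and the sheaf `Λ(L) = m^*L ⊗ p₁^*L⁻¹ ⊗ p₂^*L⁻¹`; its `T`-points are the `u : T → X` with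
`(1 × u)^*Λ(L) ≅ p_T^*𝓜` for some line bundle `𝓜` on `T`.  For `L` RIGIDIFIED along the identity section
(`ε^*[L] = 1`) this «comes from the base» condition is EQUIVALENT to triviality of `(1 × u)^*Λ(L)` (restrict along the
section `(ε_T, 𝟙) : T → X ×_S T`: `(ε, u)^*Λ(L) = u^*L ⊗ (ε^*L)⁻¹ ⊗ (u^*L)⁻¹ = 1`, so `𝓜 ≅ 𝒪_T`), which is the
tree's `MemKOfL` ([MumfordFogartyKirwan1994] App. 7B, Definition of `H(L)`).

## What is proved (theorems only; no `def`, no instance, no notation, no named fact, no `sorry`)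

* §1 (any base `S`, any `T ∈ Over S`) `memKOfL_iff_exists_iso_pullback_snd` — **`u ∈ K(L)(T)` iff `(1_A × u)^*Λ(L) ≅ p_T^*𝓜` for some rank-one `𝓜` on `T`**
  (the seesaw-shaped form of membership).
* §2 (affine base `Spec R`) `exists_isClosedImmersion_iff_memKOfL` — **`K(L)` IS (the functor of points of) A CLOSED
  SUBSCHEME `Z ↪ A`**, from ★ `SeesawRelative.exists_seesawSubscheme_of_repr'` under its standing hypotheses: `A → Spec R`
  geometrically integral and universally Stein (`UnivStein`), and the Grothendieck-complex representabilities `hX`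
  (`H0Repr` / `DualRepr`) of the ONE family `(p₂ : A ×_R A → A, Λ(L))` — the (h2)/(h8) engine seam, named, not asserted;
  `exists_isClosedImmersion_iff_mem_kOfL` — subgroup spelling; `existsUnique_fac_of_memKOfL` — uniqueness of the
  factorisation (closed immersions are monomorphisms).
* §2 (ed. 2) `exists_one_mul_inv_fac_of_memKOfL`, `exists_isClosedImmersion_subgroup_iff_memKOfL` — the representing
  closed subscheme is STABLE UNDER THE GROUP LAW (unit / product / inverse factor through `Z`), Prop-level.

## References
* [MumfordAV1970] D. Mumford, *Abelian Varieties* (1970), §10 Seesaw theorem (p. 89); §13 the group `K(L)` (p. 123).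
* [MumfordFogartyKirwan1994] D. Mumford, J. Fogarty, F. Kirwan, *Geometric Invariant Theory*, 3rd ed. (1994), Ch. 6 §2
  Definition 6.2 (p. 120); App. 7B, Definition of `H(L)` (p. 240).
* [GortzWedhorn2023] U. Görtz, T. Wedhorn, *Algebraic Geometry II* (2023), Thm. 24.66 (p. 405).
-/

noncomputable section

-- `Scheme.Modules` / `SheafOfModules` are not reducible; `(A.X ⊗ T).left` unfolds by `rfl` only (as in ★ `AbelianSchemeKOfL`).
set_option backward.isDefEq.respectTransparency false

universe u

open CategoryTheory CategoryTheory.Limits AlgebraicGeometry MonoidalCategory CartesianMonoidalCategory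

open scoped MonObj

namespace Literature.AlgebraicGeometry.AbelianSchemes

open Literature.AlgebraicGeometry.Motives Literature.AlgebraicGeometry.AbelianVarieties
  Literature.AlgebraicGeometry.Modules

namespace AbelianSchemeOver

/-! ### §1 Membership in `K(L)` in seesaw shape («`(1 × u)^*Λ(L)` comes from the base») -/

section SeesawShape

variable {S : Scheme.{u}} (A : AbelianSchemeOver S) {L : A.left.Modules} {T : Over S}

/-- **Seesaw shape of membership in `K(L)`** ([MumfordAV1970] §13 «the maximal subscheme over which `m^*L ⊗ p₁^*L⁻¹`
comes from the base»): for `L` of rank one rigidified along the identity section, `u ∈ K(L)(T)` iff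
`(1_A × u)^*Λ(L) ≅ p_T^*𝓜` for SOME rank-one module `𝓜` on `T`.  (⇒ with `𝓜 = 𝒪_T`; ⇐ by restricting the class
identity along the section `(1, 𝟙_T) : T → A ×_S T`, where `(1, u)^*[Λ(L)] = 1` (★ `pullback_lift_one_mumfordClass`),
so `[𝓜] = 1`.) [cite: MumfordAV1970, §13 (p. 123)] [cite: MumfordFogartyKirwan1994, App. 7B, Definition of H(L) (p. 240)] -/
theorem memKOfL_iff_exists_iso_pullback_snd (hL : HasRank L 1)
    (hε : CechPic.pullback A.unitSection (detClass (HasRank.isFiniteLocallyFree' hL)) = 1) (u : T ⟶ A.X) :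
    A.MemKOfL L u ↔ ∃ (𝓜 : T.left.Modules) (_ : HasRank 𝓜 1),
      Nonempty ((Scheme.Modules.pullback (A.X ◁ u).left).obj (A.mumfordBundle L) ≅
        (Scheme.Modules.pullback (snd A.X T).left).obj 𝓜) := by
  have hΛ := A.hasRank_mumfordBundle hL
  have hΛu : HasRank ((Scheme.Modules.pullback (A.X ◁ u).left).obj (A.mumfordBundle L)) 1 := hasRank_pullback _ hΛ
  -- class form of «`(1 × u)^*Λ(L) ≅ p_T^*𝓜`»
  have key : ∀ (𝓜 : T.left.Modules) (h𝓜 : HasRank 𝓜 1),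
      Nonempty ((Scheme.Modules.pullback (A.X ◁ u).left).obj (A.mumfordBundle L) ≅
        (Scheme.Modules.pullback (snd A.X T).left).obj 𝓜) ↔
      CechPic.pullback (A.X ◁ u).left (A.mumfordClass (detClass (HasRank.isFiniteLocallyFree' hL))) =
        CechPic.pullback (snd A.X T).left (detClass (HasRank.isFiniteLocallyFree' h𝓜)) := by
    intro 𝓜 h𝓜
    rw [nonempty_iso_iff_detClass_eq hΛu (hasRank_pullback _ h𝓜) ((HasRank.isFiniteLocallyFree' hΛ).pullback _)
        ((HasRank.isFiniteLocallyFree' h𝓜).pullback _), detClass_pullback _ (HasRank.isFiniteLocallyFree' hΛ),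
      detClass_pullback _ (HasRank.isFiniteLocallyFree' h𝓜), A.detClass_mumfordBundle hL]
  constructor
  · intro hu
    refine ⟨SheafOfModules.unit _, hasRank_unitModule, (key _ hasRank_unitModule).2 ?_⟩
    rw [(A.memKOfL_iff_mumfordClass hL u).1 hu, detClass_unitModule_eq_one, map_one]
  · rintro ⟨𝓜, h𝓜, h⟩
    have hcl := (key 𝓜 h𝓜).1 h
    -- restrict along the section `(1, 𝟙_T) : T → A ×_S T`
    have hσ := congrArg (CechPic.pullback (lift (1 : T ⟶ A.X) (𝟙 T)).left) hcl
    rw [← pullback_comp_left, ← pullback_comp_left, ← A.lift_eq_lift_id_comp_whiskerLeft, lift_snd,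
      A.pullback_lift_one_mumfordClass (hε := hε), Over.id_left, CechPic.pullback_id_apply] at hσ
    rw [A.memKOfL_iff_mumfordClass hL, hcl, ← hσ, map_one]

end SeesawShape

/-! ### §2 `K(L)` is a closed subscheme of `A` (over an affine base, from the relative seesaw theorem) -/

section Closed

open SeesawRelative

variable {R : Type} [CommRing R] (A : AbelianSchemeOver (Spec (.of R)))

/-- **`K(L) ↪ A` is a closed subscheme** ([MumfordAV1970] §13 via the seesaw theorem §10; [GortzWedhorn2023] Thm. 24.66):
for an abelian scheme `A` over an affine base `Spec R` whose structure morphism is geometrically integral and universally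
Stein, a rank-one `L` on `A` rigidified along the identity section, and GIVEN the Grothendieck-complex representabilities
`hX` of the family `(p₂ : A ×_R A → A, Λ(L))` on every affine open of `A` (★ `SeesawRelative.H0Repr` / `DualRepr` — the
inputs of ★ `exists_seesawSubscheme_of_repr'`, named here, not asserted), there is a closed immersion `i : Z ↪ A` over
`Spec R` whose `T`-points are exactly `K(L)(T)` for every `T` over `Spec R`.
[cite: MumfordAV1970, §13 (p. 123)] [cite: MumfordAV1970, §10 (p. 89)] [cite: GortzWedhorn2023, Thm. 24.66 (p. 405; proof pp. 407–408)] -/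
theorem exists_isClosedImmersion_iff_memKOfL [GeometricallyIntegral A.X.hom] (hSt : UnivStein A.X) {L : A.left.Modules}
    (hL : HasRank L 1) (hε : CechPic.pullback A.unitSection (detClass (HasRank.isFiniteLocallyFree' hL)) = 1)
    (hX : ∀ U : A.X.left.affineOpens,
      H0Repr A.X (A.mumfordBundle L) U ∧ DualRepr A.X (A.mumfordBundle L) U (A.hasRank_mumfordBundle hL)) :
    ∃ (Z : Over (Spec (.of R))) (i : Z ⟶ A.X) (_ : IsClosedImmersion i.left),
      ∀ (T : Over (Spec (.of R))) (u : T ⟶ A.X), (∃ v : T ⟶ Z, v ≫ i = u) ↔ A.MemKOfL L u := by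
  haveI := A.isSmooth
  obtain ⟨Z, i, hi, hZ⟩ := exists_seesawSubscheme_of_repr' A.X hSt A.X (A.mumfordBundle L) (A.hasRank_mumfordBundle hL) hX
  exact ⟨Z, i, hi, fun T u => (hZ T u).trans (A.memKOfL_iff_exists_iso_pullback_snd hL hε u).symm⟩

/-- Subgroup spelling: the `T`-points of the closed subscheme `Z ↪ A` are the subgroup `K(L)(T) ≤ A(T)` (★ `kOfL`).
[cite: MumfordAV1970, §13 (p. 123)] [cite: MumfordFogartyKirwan1994, App. 7B, Definition of H(L) (p. 240)] -/
theorem exists_isClosedImmersion_iff_mem_kOfL [GeometricallyIntegral A.X.hom] (hSt : UnivStein A.X) {L : A.left.Modules}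
    (hL : HasRank L 1) (hε : CechPic.pullback A.unitSection (detClass (HasRank.isFiniteLocallyFree' hL)) = 1)
    (hX : ∀ U : A.X.left.affineOpens,
      H0Repr A.X (A.mumfordBundle L) U ∧ DualRepr A.X (A.mumfordBundle L) U (A.hasRank_mumfordBundle hL)) :
    ∃ (Z : Over (Spec (.of R))) (i : Z ⟶ A.X) (_ : IsClosedImmersion i.left),
      ∀ (T : Over (Spec (.of R))) (u : T ⟶ A.X), (∃ v : T ⟶ Z, v ≫ i = u) ↔ u ∈ A.kOfL L hL hε T :=
  A.exists_isClosedImmersion_iff_memKOfL hSt hL hε hX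

/-- **Uniqueness of the factorisation** through the closed subscheme `Z ↪ A` of `exists_isClosedImmersion_iff_memKOfL`
(a closed immersion is a monomorphism of schemes, hence of `Spec R`-schemes): every `u ∈ K(L)(T)` factors UNIQUELY.
[cite: MumfordAV1970, §13 (p. 123)] [cite: GortzWedhorn2023, Thm. 24.66 (p. 405; proof pp. 407–408)] -/
theorem existsUnique_fac_of_memKOfL {Z : Over (Spec (.of R))} (i : Z ⟶ A.X) [IsClosedImmersion i.left]
    {L : A.left.Modules} (hZ : ∀ (T : Over (Spec (.of R))) (u : T ⟶ A.X), (∃ v : T ⟶ Z, v ≫ i = u) ↔ A.MemKOfL L u)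
    {T : Over (Spec (.of R))} {u : T ⟶ A.X} (hu : A.MemKOfL L u) : ∃! v : T ⟶ Z, v ≫ i = u := by
  obtain ⟨v, hv⟩ := (hZ T u).2 hu
  refine ⟨v, hv, fun w hw => Over.OverMorphism.ext ((cancel_mono i.left).1 ?_)⟩
  rw [← Over.comp_left, ← Over.comp_left, hw, hv]

/-- **`K(L) ↪ A` is closed under the group law** (Prop-level group-object structure on the representing closed
subscheme): if the closed immersion `i : Z ↪ A` represents `K(L)` (as in `exists_isClosedImmersion_iff_memKOfL`), then the
unit point, the product `p₁·p₂ : Z ×_R Z → A` of the two projections and the inverse of `i` all factor (uniquely, `i` being a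
monomorphism) through `Z` — because `K(L)(T) ≤ A(T)` is a subgroup for every `T` (★ `kOfL`) and `i ∈ K(L)(Z)`.  Any consumer
can assemble Mathlib's `GrpObj Z` / `IsMonHom i` from these three factorisations; no data is defined here.
[cite: MumfordAV1970, §13 (p. 123)] [cite: MumfordFogartyKirwan1994, App. 7B, Definition of H(L) (p. 240)] -/
theorem exists_one_mul_inv_fac_of_memKOfL {Z : Over (Spec (.of R))} (i : Z ⟶ A.X) {L : A.left.Modules} (hL : HasRank L 1)
    (hε : CechPic.pullback A.unitSection (detClass (HasRank.isFiniteLocallyFree' hL)) = 1)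
    (hZ : ∀ (T : Over (Spec (.of R))) (u : T ⟶ A.X), (∃ v : T ⟶ Z, v ≫ i = u) ↔ A.MemKOfL L u) :
    (∃ e : 𝟙_ (Over (Spec (.of R))) ⟶ Z, e ≫ i = 1) ∧
      (∃ m : Z ⊗ Z ⟶ Z, m ≫ i = (fst Z Z ≫ i) * (snd Z Z ≫ i)) ∧ ∃ n : Z ⟶ Z, n ≫ i = i⁻¹ := by
  have hi : i ∈ A.kOfL L hL hε Z := (A.mem_kOfL_iff hL hε i).2 ((hZ Z i).1 ⟨𝟙 Z, Category.id_comp i⟩)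
  refine ⟨(hZ _ _).2 ((A.mem_kOfL_iff hL hε _).1 (A.kOfL L hL hε _).one_mem), (hZ _ _).2 ((A.mem_kOfL_iff hL hε _).1 ?_),
    (hZ _ _).2 ((A.mem_kOfL_iff hL hε _).1 ((A.kOfL L hL hε Z).inv_mem hi))⟩
  exact (A.kOfL L hL hε _).mul_mem (A.comp_mem_kOfL hL hε _ hi) (A.comp_mem_kOfL hL hε _ hi)

/-- The same three factorisations, packaged with `exists_isClosedImmersion_iff_memKOfL`: **`K(L)` is (the functor of points
of) a closed subscheme of `A` STABLE UNDER THE GROUP LAW** (unit, product of the projections, inverse), over an affine base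
and modulo the relative seesaw inputs. [cite: MumfordAV1970, §13 (p. 123)] [cite: GortzWedhorn2023, Thm. 24.66 (p. 405; proof pp. 407–408)] -/
theorem exists_isClosedImmersion_subgroup_iff_memKOfL [GeometricallyIntegral A.X.hom] (hSt : UnivStein A.X)
    {L : A.left.Modules} (hL : HasRank L 1)
    (hε : CechPic.pullback A.unitSection (detClass (HasRank.isFiniteLocallyFree' hL)) = 1)
    (hX : ∀ U : A.X.left.affineOpens,
      H0Repr A.X (A.mumfordBundle L) U ∧ DualRepr A.X (A.mumfordBundle L) U (A.hasRank_mumfordBundle hL)) :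
    ∃ (Z : Over (Spec (.of R))) (i : Z ⟶ A.X) (_ : IsClosedImmersion i.left),
      (∀ (T : Over (Spec (.of R))) (u : T ⟶ A.X), (∃ v : T ⟶ Z, v ≫ i = u) ↔ A.MemKOfL L u) ∧
      (∃ e : 𝟙_ (Over (Spec (.of R))) ⟶ Z, e ≫ i = 1) ∧
        (∃ m : Z ⊗ Z ⟶ Z, m ≫ i = (fst Z Z ≫ i) * (snd Z Z ≫ i)) ∧ ∃ n : Z ⟶ Z, n ≫ i = i⁻¹ := by
  obtain ⟨Z, i, hi, hZ⟩ := A.exists_isClosedImmersion_iff_memKOfL hSt hL hε hX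
  exact ⟨Z, i, hi, hZ, A.exists_one_mul_inv_fac_of_memKOfL i hL hε hZ⟩

end Closed

end AbelianSchemeOver

end Literature.AlgebraicGeometry.AbelianSchemes

end
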